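import Summits.NavierStokesRegularity.NavierStokesRegularity.Theorems.StrongHypothesesLerayHopfSobolevHalfBoundBridge
import Literature.Analysis.FunctionSpaces.FourierSobolevNormProofs
import Literature.Analysis.FunctionSpaces.Complexify
import Mathlib.Analysis.Distribution.Sobolev
import Literature.Claims.NS.Ri2025
import HarnessLib

/-!
# Solo salvage for claim C08 `Ri2025` (cell `ns-claims`, D-0090): TRUE steps, kernel-discharged — part 0 (skeleton-independent)

Claim: M. Ri, arXiv:2508.19590v1 (17 pp.), main theorem (abstract): «any Leray–Hopf weak solution of
the 3-D Navier–Stokes equations with u₀ ∈ H^{1/2}(ℝ³) belongs to L^∞(0,∞;H^{1/2}(ℝ³)) and thus is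
regular». Adjudication in progress (typist-9: skeleton `Literature.Claims.NS.Ri2025` not yet landed;
refuter-5 R-PREDICTION: first failing step = the averaging bound of §3 Step 2, .clean.tex
l.806–839, class false lemma by an explicit counting witness; ref-3 RETYPE v0). This SALVAGE file
(seat `ns-claims-salvage-p4`, solo lane `Theorems/SoloSalvage<Slug>.lean`, no item) records the TRUE
parts in the kernel:

* the closing implication «thus it is regular» ⇒ Clay (A) is ALREADY landed by this seat as the
  Strong-Hypothesis bridges `Summit.NavierStokesRegularity.StrongHypotheses.`
  `LerayHopfLThreeBoundImpliesNavierStokesRegularity_holds` (p458363; ESS 2003 Thm 1.4),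
  `navierStokesRegularity_of_lerayHopfHomSobolevHalfBound` (p458804; + Sobolev `Ḣ^{1/2} ↪ L³`,
  BCD 2011 Thm 1.38) and `navierStokesRegularity_of_lerayHopfSobolevHalfBound` (p461705;
  inhomogeneous `H^{1/2}`);
* this part 0 supplies the remaining glue for the composition `ClaimedTheorem → (A)` once the
  skeleton lands, namely that CLAY DATA ARE `H^s` DATA: `memFourierSobolev_schwartz` (Schwartz maps
  lie in every `H^s`; Mathlib `SchwartzMap.memSobolev` through the tree's bridge
  `memSobolev_two_iff_eFourierSobolevNorm_lt_top_holds`) and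
  `memFourierSobolev_complexify_of_hasRapidSpatialDecay` (a `C^∞` field with Fefferman's decay (4)
  has complexification in `H^s(ℝ³)` for every `s`) — public versions of lemmas that so far exist in
  the tree only as private `Ḣ^{1/2}` copies (`…RusinSverakThreshold.lean`,
  `…AxisymmetricKatoGlobalFalseWithoutDivFree.lean`);
* to be APPENDED when `Literature.Claims.NS.Ri2025` lands: `clay_of_claimedTheorem :
  ClaimedTheorem → NavierStokesRegularity` (typist-9's CARD §3 plan: the claim is (A)-STRONGER) and
  `Step_k_holds` for the classical steps (Leray–Hopf existence `leray_existence_R3_holds`, LP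
  almost-orthogonality, Lemmas 3.1/3.2 if typed as elementary sequence facts).

WHAT THIS IS NOT: not a claim about NS regularity or blow-up; not a claim about any author beyond the typed locator.
-/

set_option linter.dupNamespace false

noncomputable section

namespace Summit.NavierStokesRegularity.NavierStokesRegularity.Theorems.Ri2025

open Set MeasureTheory
open scoped ENNReal NNReal ContDiff SchwartzMap
open Literature.Analysis.FluidPDE Literature.Analysis.FunctionSpaces
open Literature.Analysis.FunctionSpaces.EuclideanSpace (complexify contDiff_complexify_comp_iff)

/-- Schwartz maps lie in every inhomogeneous Sobolev space `H^s` (Mathlib `SchwartzMap.memSobolev`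
read through the tree's bridge `memSobolev_two_iff_eFourierSobolevNorm_lt_top_holds`;
Bahouri–Chemin–Danchin 2011, §1.4.1). [cite: BahouriCheminDanchin2011, §1.4.1] -/
theorem memFourierSobolev_schwartz {E F : Type*} [NormedAddCommGroup E]
    [InnerProductSpace ℝ E] [FiniteDimensional ℝ E] [MeasurableSpace E] [BorelSpace E]
    [NormedAddCommGroup F] [InnerProductSpace ℂ F] [CompleteSpace F] (s : ℝ)
    (f : 𝓢(E, F)) : MemFourierSobolev s (⇑f) := by
  have hB : TemperedDistribution.MemSobolev s 2
      ((f.toLp 2 (volume : Measure E) : Lp F 2 (volume : Measure E)) : 𝓢'(E, F)) := by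
    rw [Lp.toTemperedDistribution_toLp_eq]
    exact f.memSobolev
  have h := memSobolev_two_iff_eFourierSobolevNorm_lt_top_holds (E := E) (F := F)
  exact ⟨f.memLp 2 volume, (h s _).1 hB⟩

/-- **Clay data are `H^{1/2}` data**: a smooth (`C^∞`) field on `ℝ³` with Fefferman's decay (4)
(`HasRapidSpatialDecay`) has complexification in `H^{1/2}(ℝ³)` (indeed in every `H^s`): the decay
bounds are the Schwartz seminorm bounds and `complexify` is an `ℝ`-linear isometry.
[cite: BahouriCheminDanchin2011, §1.4.1] -/
theorem memFourierSobolev_complexify_of_hasRapidSpatialDecay (s : ℝ)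
    {v : EuclideanSpace ℝ (Fin 3) → EuclideanSpace ℝ (Fin 3)} (hsm : ContDiff ℝ ∞ v)
    (hdec : HasRapidSpatialDecay v) :
    MemFourierSobolev s (complexify ∘ v) := by
  have hdecay : ∀ k n : ℕ, ∃ C : ℝ, ∀ x : EuclideanSpace ℝ (Fin 3),
      ‖x‖ ^ k * ‖iteratedFDeriv ℝ n (complexify ∘ v) x‖ ≤ C := by
    intro k n
    obtain ⟨C, hC⟩ := hdec n k
    refine ⟨C, fun x => le_trans ?_ (hC x)⟩
    rw [(complexify (ι := Fin 3)).norm_iteratedFDeriv_comp_left hsm.contDiffAt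
      (mod_cast le_top)]
    exact mul_le_mul_of_nonneg_right
      (pow_le_pow_left₀ (norm_nonneg _) (le_add_of_nonneg_left zero_le_one) k) (norm_nonneg _)
  exact memFourierSobolev_schwartz s ⟨complexify ∘ v, contDiff_complexify_comp_iff.2 hsm, hdecay⟩


/-! ## Part 1 — the claimed theorem implies Clay (A) (kernel composition against the typed skeleton p465548) -/

/-- **`ClaimedTheorem → Clay (A)`** for C08 `Ri2025`: Theorem 1.1 AS TYPED (`Literature.Claims.NS.Ri2025.ClaimedTheorem`,
typist-7, p465548: every Leray–Hopf solution from an `H^{1/2}` weakly divergence-free datum is regular and obeys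
(1.2)) implies Fefferman's (A) (`NavierStokesRegularity`). Chain: (1.2) ⇒ the a.e.-in-time `H^{1/2}` bound
(`linftyHalfBound_of_claimedTheorem`, proved in the skeleton) ⇒ — Clay data being `H^{1/2}` data
(`memFourierSobolev_complexify_of_hasRapidSpatialDecay`) and pointwise divergence-free fields weakly
divergence-free (`VectorCalculus.IsDivFree.isWeaklyDivFree_holds`) — the bridge
`StrongHypotheses.navierStokesRegularity_of_lerayHopfSobolevHalfBound` (p461705: `H^{1/2} ↪ Ḣ^{1/2} ↪ L³` + ESS 2003).
So the claim is (A)-STRONGER in the kernel (typist's CARD §3): no wrong-problem axis. Only the implication is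
asserted; `ClaimedTheorem` itself is under adjudication (refuter-5). [cite: EscauriazaSereginSverak2003, Thm. 1.4] -/
theorem clay_of_claimedTheorem (h : Literature.Claims.NS.Ri2025.ClaimedTheorem) : _root_.NavierStokesRegularity := by
  refine Summit.NavierStokesRegularity.StrongHypotheses.navierStokesRegularity_of_lerayHopfSobolevHalfBound
    fun ν T hν hT u₀ u hs hd hdec hLH => ?_
  have hH : MemFourierSobolev (1 / 2 : ℝ) (Literature.Claims.NS.Ri2025.cplx u₀) :=
    memFourierSobolev_complexify_of_hasRapidSpatialDecay (1 / 2 : ℝ) hs hdec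
  have hwd : IsWeaklyDivFree u₀ :=
    VectorCalculus.IsDivFree.isWeaklyDivFree_holds (fun x => hd x) (hs.of_le (mod_cast le_top))
  obtain ⟨M, hMfin, hM⟩ :=
    Literature.Claims.NS.Ri2025.linftyHalfBound_of_claimedTheorem h ν hν T hT u₀ hH hwd u hLH
  refine ⟨M.toNNReal, ?_⟩
  filter_upwards [ae_restrict_mem measurableSet_Ioo] with t ht
  rw [ENNReal.coe_toNNReal hMfin.ne]
  exact hM t ht

end Summit.NavierStokesRegularity.NavierStokesRegularity.Theorems.Ri2025

end
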